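import Mathlib
import HarnessLib
import Literature.Analysis.FluidPDE.SuitableWeak
import Literature.Analysis.FluidPDE.WeakSolution
import Literature.Analysis.FluidPDE.LocalTypeI
import Summits.NavierStokesRegularity.NavierStokesRegularity.Theorems.TypeIQuarterGateSliceBudgetV7Defs
import Summits.NavierStokesRegularity.NavierStokesRegularity.Theorems.TypeIQuarterGateScarEnvelopeTypeITopTimeCKN
import Summits.NavierStokesRegularity.NavierStokesRegularity.Theorems.TypeIQuarterGateScarEnvelopeTypeIABClassTwinScar

/-!
# Crux `TypeIQuarterGate.ScarEnvelopeTypeI` (stmt-NavierStokesRegularity-23843), line `slice_budget` v7 —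
# STUB F `stub_fatKill`: every Albritton–Barker-class object has `H¹`-null final-time singular set

Proof file (no new definitions) for the stub SF `stub_fatKill : FatKill` of version 7 of line
`slice_budget` (definitions landed verbatim in `Theorems/TypeIQuarterGateSliceBudgetV7Defs.lean`).
`FatKill` says: whenever `ABClass M U P H` — KNSS-gauge Type-I ancient mild, suitable weak in every
backward ball at the top vertex, suitable weak on the open past slab `(−∞,0) × ℝ³` with weak gradient
`H`, and `𝐈((−∞,0) × ℝ³) < ⊤` — the final-time singular set `{x | (0,x) backward-singular}` is
`μH[1]`-null.  This is CKN 1982 at the top time under the Morrey bound, proved in the tree as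
`hausdorffMeasure_topSingular_eq_zero_slab` (`…TopTimeCKN.lean`, with `…TopEpsilonRegularity.lean`):
on every ball `B(0, n+1)` the singular top vertices are `H¹`-null (`𝐈(Q((0,0), 2(n+1))) ≤
𝐈((−∞,0) × ℝ³) < ⊤` by monotonicity of `𝐈`), and `ℝ³ = ⋃ₙ B(0, n+1)`.  Only the last three
conjuncts of `ABClass` are used.  It kills, with no Liouville theorem, every far-annulus
concentration scenario one of whose scar zoom limits is `H¹`-fat at the final time (coherent
filaments, arc-swarms, sheets, fog).  Also packaged here over the v7 definitions:
`octaveBudget_of_noABClassTwinScar` — the ISOLATED-SCAR statement `W` of v8 («an `ABClass` object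
singular at the origin at the final time has no final-time singular point on the unit sphere») implies
SD, by `octaveBudget_of_noABClassTwinScar'` (`…ABClassTwinScar.lean`: ¬SD ⇒ scar violators ⇒ an
A–B-class twin-scar object).

HONEST FRAMING: SK (`stub_dustKill`), SD, the crux `ScarEnvelopeTypeI`, its parent and the summit are
OPEN; nothing here is credited toward them beyond the stub SF itself.
-/

noncomputable section

-- the summit-side namespace `Summit.NavierStokesRegularity.NavierStokesRegularity.…` (single-conjunct
-- summit, D-0017) repeats a component by design; the dupNamespace linter would flag every declaration.
set_option linter.dupNamespace false

namespace Summit.NavierStokesRegularity.NavierStokesRegularity.Cruxes.ScarEnvelopeTypeI.SliceBudget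

open MeasureTheory Set Filter Topology Metric
open scoped ENNReal
open Literature.Analysis Literature.Analysis.FluidPDE
open Summit.NavierStokesRegularity.NavierStokesRegularity.Cruxes.ScarEnvelopeTypeI.ScarZoom (CruxHypotheses)

/-- The final-time singular set restricted to balls exhausts the final-time singular set. -/
theorem finalSingularSet_eq_iUnion (U : ℝ → EuclideanSpace ℝ (Fin 3) → EuclideanSpace ℝ (Fin 3)) :
    finalSingularSet U = ⋃ n : ℕ, {x ∈ ball (0 : EuclideanSpace ℝ (Fin 3)) ((n : ℝ) + 1) |
      IsBackwardSingularPoint U ((0 : ℝ), x)} := by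
  ext x
  simp only [finalSingularSet, mem_setOf_eq, mem_iUnion, mem_ball, dist_zero_right]
  constructor
  · intro hx
    obtain ⟨n, hn⟩ := exists_nat_gt ‖x‖
    exact ⟨n, by linarith, hx⟩
  · rintro ⟨n, -, hx⟩
    exact hx

/-- **STUB F (SF) of line `slice_budget` v7 — the `H¹`-fat kill.**  Every object of the
Albritton–Barker class `ABClass` has `H¹`-null final-time singular set:
`μH[1] {x | (0, x) is a backward singular point of U} = 0`.  CKN 1982 at the top time under the Morrey
bound `𝐈 < ⊤` (`hausdorffMeasure_topSingular_eq_zero_slab` on the balls `B(0, n+1)`, then countable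
subadditivity). -/
theorem stub_fatKill : FatKill := by
  intro M U P H hAB
  obtain ⟨-, -, hsw, hH, hI⟩ := hAB
  set I₀ : ℝ≥0∞ := typeIBound (Iio (0 : ℝ) ×ˢ (univ : Set (EuclideanSpace ℝ (Fin 3)))) U P H with hI₀
  have hItop : I₀ ≠ ⊤ := hI.ne
  rw [finalSingularSet_eq_iUnion]
  refine (measure_iUnion_null_iff).2 fun n => ?_
  have hR : (0 : ℝ) < 2 * ((n : ℝ) + 1) := by positivity
  have hcyl : parabolicCylinder (2 * ((n : ℝ) + 1)) ((0 : ℝ), (0 : EuclideanSpace ℝ (Fin 3))) ⊆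
      Iio (0 : ℝ) ×ˢ (univ : Set (EuclideanSpace ℝ (Fin 3))) := by
    intro w hw
    rw [mem_parabolicCylinder] at hw
    exact ⟨hw.1.2, mem_univ _⟩
  have hbd : typeIBound (parabolicCylinder (2 * ((n : ℝ) + 1))
      ((0 : ℝ), (0 : EuclideanSpace ℝ (Fin 3)))) U P H ≤ I₀ := typeIBound_mono hcyl
  have h := hausdorffMeasure_topSingular_eq_zero_slab (I := Iio 0) (hI := isOpen_Iio) hsw hH
    (t₀ := 0) (x₀ := 0) hR (fun s hs => hs.2) hItop hbd
  have e : 2 * ((n : ℝ) + 1) / 2 = (n : ℝ) + 1 := by ring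
  rw [e] at h
  exact h


/-- **v8's `W → SD`, packaged over `ABClass` / `finalSingularSet`**: if every A–B-class object that is
backward singular at `(0,0)` has no final-time singular point on the unit sphere (the isolated-scar
Liouville statement `W`, OPEN), then the slice-wise octave budget SD holds for every crux-class blow-up
(`octaveBudget_of_noABClassTwinScar'`). -/
theorem octaveBudget_of_noABClassTwinScar
    (hW : ∀ (M : ℝ) (U : ℝ → EuclideanSpace ℝ (Fin 3) → EuclideanSpace ℝ (Fin 3))
      (P : ℝ → EuclideanSpace ℝ (Fin 3) → ℝ)
      (H : ℝ → EuclideanSpace ℝ (Fin 3) → EuclideanSpace ℝ (Fin 3) →L[ℝ] EuclideanSpace ℝ (Fin 3)),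
      ABClass M U P H → (0 : EuclideanSpace ℝ (Fin 3)) ∈ finalSingularSet U →
        ∀ e : EuclideanSpace ℝ (Fin 3), ‖e‖ = 1 → e ∉ finalSingularSet U)
    {ν T : ℝ} {u : ℝ → EuclideanSpace ℝ (Fin 3) → EuclideanSpace ℝ (Fin 3)}
    {p : ℝ → EuclideanSpace ℝ (Fin 3) → ℝ} (hH : CruxHypotheses ν T u p) : OctaveBudget ν T u :=
  octaveBudget_of_noABClassTwinScar' (fun M U P H hAB h0 e he hse => hW M U P H hAB h0 e he hse) hH

end Summit.NavierStokesRegularity.NavierStokesRegularity.Cruxes.ScarEnvelopeTypeI.SliceBudget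

end
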